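import Literature.Geometry.Riemannian.AlmostNonnegRicciFibrationLimit
import Literature.Geometry.MetricGeometry.PointedGHPrecompactness
import HarnessLib

/-!
# Huang–Huang–Wang–Zhu 2026, Main Theorem 1 at `n = 4`, `b₁ = 1`: the pointed limit of the covers
of a contradiction sequence, given uniform covering bounds

Seventh reduction file for the named fact
`Literature.Geometry.Riemannian.huangHuangWangZhu2026_fibresOverCircle_four`. Huang–Huang–Wang–Zhu
2026, §4 p. 13: "Up to passing to a subsequence, we consider the following commutative diagram
(4.1): `(M̂ᵢ, p̂ᵢ, Hᵢ) →_GH (ℝˢ × Ŷ, (0ˢ, ŷ_∞), H)`". The passage to a convergent subsequence is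
Thm 2.1 (§2.1 p. 6), whose metric half — Gromov's precompactness theorem in pointed form — is the
tree's `MetricGeometry/PointedGHPrecompactness.lean`; its analytic input is a bound, uniform in `i`,
on the number of `ε`-balls needed to cover `B̄(p̂ᵢ, R) ⊆ M̂ᵢ`, which for the covers (complete,
`Ric ≥ -δᵢ ĝᵢ`, `δᵢ ≤ 1`, dimension `4`: `AlmostNonnegRicciFibrationCovers.lean`) is Bishop–Gromov
relative volume comparison — NOT in the tree, and therefore kept here as the explicit hypothesis
`hcov`. Under it, for a sequence `D : (i : ℕ) → CoreDatum κ (δ i)` with base points `p̂ᵢ`: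

* `CoreDatum.exists_strictMono_pointedGHConv` — **a subsequence of the covers converges in the
  pointed Gromov–Hausdorff sense (`PointedGHConv`) to the ultralimit `Y = lim_U M̂ᵢ`, a proper
  metric space**;
* `CoreDatum.ultralimit_exists_segment`, `CoreDatum.ultralimit_exists_line`,
  `CoreDatum.ultralimit_noncompactSpace` — **`Y` is geodesic, contains a line within distance `1`
  of its base point, and is not compact** (`AlmostNonnegRicciFibrationLimit.lean` along the
  subsequence).

What then remains of §4 for `b = 1` is entirely analytic: the covering bound (Bishop–Gromov), the
limit group (pointed equivariant version of `EquivariantGHLimit.lean`), the splitting `Y = ℝ × Ŷ`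
(Cheeger–Colding / Gigli), Thm 1.11 and Thm 2.9. Proved theorems only; no named facts.

## References

* H. Huang, X.-T. Huang, J. Wang, X. Zhu, arXiv:2605.24380 (2026), §2.1 p. 6 (Thm 2.1), §4 p. 13
  (diagram (4.1)). [HuangHuangWangZhu2026]
-/

noncomputable section

open scoped Manifold ContDiff Topology
open Function Set Filter Metric

namespace Literature.Geometry.Riemannian

open Literature.Geometry.MetricGeometry Literature.Topology.FourManifolds.CircleMaps

namespace CoreDatum

variable {κ : ℝ} {δ : ℕ → ℝ} (D : (i : ℕ) → CoreDatum κ (δ i)) (p : ∀ i, (D i).Cover)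

/-- **A subsequence of the covers `(M̂ᵢ, p̂ᵢ)` of a contradiction sequence converges in the pointed
Gromov–Hausdorff sense to a proper limit**, given uniform covering bounds for their balls
(Huang–Huang–Wang–Zhu 2026, Thm 2.1 first assertion, via `exists_strictMono_pointedGHConv_hyperfilter`;
the limit is the ultralimit along the hyperfilter). [cite: HuangHuangWangZhu2026, §2.1 p. 6 Thm 2.1 and §4 p. 13] -/
theorem exists_strictMono_pointedGHConv
    (hcov : letI := coverMetricSpaces D
      ∀ (R ε : ℝ), 0 < ε → ∃ N : ℕ, ∀ i, ∃ S : Finset ((D i).Cover), S.card ≤ N ∧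
        ∀ x ∈ closedBall (p i) R, ∃ s ∈ S, dist x s ≤ ε) :
    letI := coverMetricSpaces D
    ProperSpace (Ultralimit p (hyperfilter ℕ)) ∧
      ∃ φ : ℕ → ℕ, StrictMono φ ∧
        PointedGHConv (fun n ↦ p (φ n)) (Ultralimit.basePt p (hyperfilter ℕ)) := by
  letI := coverMetricSpaces D
  exact exists_strictMono_pointedGHConv_hyperfilter hcov

/-- **The limit is a geodesic space.** [cite: HuangHuangWangZhu2026, §4 pp. 13–14] -/
theorem ultralimit_exists_segment
    (hcov : letI := coverMetricSpaces D
      ∀ (R ε : ℝ), 0 < ε → ∃ N : ℕ, ∀ i, ∃ S : Finset ((D i).Cover), S.card ≤ N ∧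
        ∀ x ∈ closedBall (p i) R, ∃ s ∈ S, dist x s ≤ ε) :
    letI := coverMetricSpaces D
    ∀ y y' : Ultralimit p (hyperfilter ℕ), ∃ σ : ℝ → Ultralimit p (hyperfilter ℕ),
      σ 0 = y ∧ σ (dist y y') = y' ∧
        ∀ s ∈ Icc 0 (dist y y'), ∀ t ∈ Icc 0 (dist y y'), dist (σ s) (σ t) = |s - t| := by
  letI := coverMetricSpaces D
  obtain ⟨hP, φ, hφ, hconv⟩ := exists_strictMono_pointedGHConv D p hcov
  haveI := hP
  intro y y'
  exact limit_exists_segment (fun n ↦ D (φ n)) (fun n ↦ p (φ n)) hconv y y'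

/-- **The limit contains a line within distance `1` of its base point** (the Cheeger–Gromoll-trick
input for diagram (4.1)). [cite: HuangHuangWangZhu2026, §4 p. 13] -/
theorem ultralimit_exists_line
    (hcov : letI := coverMetricSpaces D
      ∀ (R ε : ℝ), 0 < ε → ∃ N : ℕ, ∀ i, ∃ S : Finset ((D i).Cover), S.card ≤ N ∧
        ∀ x ∈ closedBall (p i) R, ∃ s ∈ S, dist x s ≤ ε) :
    letI := coverMetricSpaces D
    ∃ σ : ℝ → Ultralimit p (hyperfilter ℕ), Isometry σ ∧
      dist (σ 0) (Ultralimit.basePt p (hyperfilter ℕ)) ≤ 1 := by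
  letI := coverMetricSpaces D
  obtain ⟨hP, φ, hφ, hconv⟩ := exists_strictMono_pointedGHConv D p hcov
  haveI := hP
  exact limit_exists_line (fun n ↦ D (φ n)) (fun n ↦ p (φ n)) hconv

/-- **The limit is not compact.** [cite: HuangHuangWangZhu2026, §4 p. 13] -/
theorem ultralimit_noncompactSpace
    (hcov : letI := coverMetricSpaces D
      ∀ (R ε : ℝ), 0 < ε → ∃ N : ℕ, ∀ i, ∃ S : Finset ((D i).Cover), S.card ≤ N ∧
        ∀ x ∈ closedBall (p i) R, ∃ s ∈ S, dist x s ≤ ε) :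
    letI := coverMetricSpaces D
    NoncompactSpace (Ultralimit p (hyperfilter ℕ)) := by
  letI := coverMetricSpaces D
  obtain ⟨hP, φ, hφ, hconv⟩ := exists_strictMono_pointedGHConv D p hcov
  haveI := hP
  exact limit_noncompactSpace (fun n ↦ D (φ n)) (fun n ↦ p (φ n)) hconv

end CoreDatum

end Literature.Geometry.Riemannian
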